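/-
Copyright (c) 2026 the pub-hodgecm-mathlib formalisation cell (harness21).  Prover seat hodgecm-mathlib-B-p14 (g35): road «S3-tree» (LEAD F0P3a-plan (g11) WORD T10-2; architect A-p16 (g28)
census «S3» v3 = DEAL SHEET, acting architect F0P3-p01 (g16)), brick T1 «the `U(3)_v` tree», file T1d-B = THE PARENT OF A SELF-DUAL VERTEX; 2026-09-01.
-/
import Literature.NumberTheory.Automorphic.UnitaryLatticeTreeApartment   -- ★ T1d-A (B-p14 (g35)): equivariance, types along edges, the apartment `L_a`, `L′_a`, `N₁`
import HarnessLib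

/-!
# The lattice graph of a hermitian space — VI: THE PARENT OF A SELF-DUAL VERTEX of the `U(3)` tree is a type-two vertex strictly below it at the same depth
# (intersections and duals of `ϖ`-power diagonal lattices at `J₀`; Bruhat–Tits 1972 §10; Serre, *Trees* II.1.1)

Topic `NumberTheory/Automorphic`; namespace `Literature.NumberTheory.Automorphic.UnitaryLatticeTree`.  THEOREMS ONLY (no definition, no instance, no notation, no named fact,
no `sorry`); kernel lane.  Cell `pub/hodgecm-mathlib` (D-0151), crux H413 = `stmt-HodgeConjecture-24833`; road «S3-tree» (census «S3» v3 §1 rulings A-49/A-53), brick **T1** over ★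
`UnitaryLatticeTreeDefs` ∕ `…Dual` ∕ `…Types` ∕ `…SelfDualFrames` ∕ `…Apartment`.  This file is the FIRST HALF of the rooted structure that makes `latticeGraph σ ϖ J₀` (at `N = 3`) a tree by
★ `TreeRootedCriterionFixedSubtree.isTree_of_parent` (root `𝒪³`, level `2·depth` ∕ `2·depth − 1`, parent `latticeParent`): the parent of a SELF-DUAL vertex.  The second half (the parent
of a type-two vertex, over the transitivity hypothesis «`U(J₀)` acts transitively on type-two vertices» = rank-2's (hB) binder) and the `IsTree` head are the sequel T1d-C.
HONEST LABEL: HC_CM is proved only modulo the 2 remaining named inputs (hLiu418 24832, h413 24833) until rung 0 closes; nothing printed is asserted here (elementary lattice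
algebra over a valuation ring); S3 stays a print row until the road's END lands.

* §18 (over ★ `CartanUnique.v_uniformizer_zpow` ∕ `uniformizer_ne_zero`) **`latt_diagonal_zpow_inf_scaleLattice_zpow`** (`latt diag(ϖ^{e_i}) ⊓ ϖ^j𝒪^N = latt diag(ϖ^{max(e_i,j)})`, any `N`),
  `antidiagonal_mul_diagonal` (`J₀·diag(f) = diag(f∘rev)·J₀`), **`latt_antidiagonal`** (`latt J₀ = 𝒪^N`), `latt_mul_antidiagonal`, **`dualLatt_latt_diagonal_zpow`**
  (`(latt diag(ϖ^{e_i}))^♯ = latt diag(ϖ^{−e_{rev i}})` at `J₀`, `σϖ = ϖ`), the `Fin 3` forms `latt_diagonal_three_inf_scaleLattice`, `dualLatt_latt_diagonal_three`, `vec_three_zpow_eq`, `diagonal_one_mid_eq`.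
* §19 `latt_diagonal_zpow_zero`, **`latticeParent_spec_of_isSelfDualLattice`** (`N = 3`, `UnramifiedLocalConjDatum σ ϖ`; `L ≠ 𝒪³` self-dual of depth `k` ⇒ `k ≥ 1`, the parent
  `L ⊓ ϖ^{1−k}𝒪³` has type `2`, is `< L`, and has depth `k`).

## References
* [BruhatTits1972] F. Bruhat, J. Tits, *Groupes réductifs sur un corps local I*, Publ. Math. IHÉS 41 (1972), §10 (the building of a rank-one group is a tree).
* [Tits1979] J. Tits, *Reductive groups over local fields*, PSPM 33.1 (1979), §3.3.3.
* [Serre1980Trees] J.-P. Serre, *Trees* (1980), Ch. II §1.1 (lattices, distance from a base lattice, the rooted structure).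
* [Jacobowitz1962] R. Jacobowitz, *Hermitian forms over local fields*, Amer. J. Math. 84 (1962), §4, §7–§8.
-/

set_option autoImplicit false

noncomputable section

open scoped Valued WithZero Matrix MatrixGroups

namespace Literature.NumberTheory.Automorphic.UnitaryLatticeTree

open Literature.NumberTheory.Automorphic Literature.NumberTheory.Automorphic.HermitianLattice
open Literature.NumberTheory.Automorphic.CartanUnique

variable {K : Type*} [Field K] [Valued K ℤᵐ⁰] {σ : K →+* K} {ϖ : K} {N : ℕ}

/-! ## §18 Diagonal lattices of `ϖ`-powers: intersection with the scaled root, the antidiagonal permutation, duals -/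

/-- **Intersection of a `ϖ`-power diagonal lattice with a scaled root**: `latt diag(ϖ^{e_i}) ⊓ ϖ^j·𝒪^N = latt diag(ϖ^{max(e_i, j)})`. [cite: Serre1980Trees, II.1.1] -/
theorem latt_diagonal_zpow_inf_scaleLattice_zpow (hϖ : Valued.v ϖ = WithZero.exp (-1 : ℤ)) (e : Fin N → ℤ) (j : ℤ) :
    latt (Matrix.diagonal fun i => ϖ ^ e i) ⊓ scaleLattice (ϖ ^ j) (stdLattice K N) = latt (Matrix.diagonal fun i => ϖ ^ max (e i) j) := by
  have hϖ0 := uniformizer_ne_zero hϖ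
  ext x
  rw [Submodule.mem_inf, mem_latt_diagonal_iff (fun i => zpow_ne_zero _ hϖ0), mem_scaleLattice_stdLattice_iff (zpow_ne_zero _ hϖ0),
    mem_latt_diagonal_iff (fun i => zpow_ne_zero _ hϖ0)]
  simp only [v_uniformizer_zpow hϖ]
  constructor
  · rintro ⟨h1, h2⟩ i
    rcases le_total (e i) j with h | h
    · rw [max_eq_right h]; exact h2 i
    · rw [max_eq_left h]; exact h1 i
  · intro h
    refine ⟨fun i => (h i).trans (WithZero.exp_le_exp.2 ?_), fun i => (h i).trans (WithZero.exp_le_exp.2 ?_)⟩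
    · exact neg_le_neg (le_max_left _ _)
    · exact neg_le_neg (le_max_right _ _)

omit [Valued K ℤᵐ⁰] in
/-- `J₀ · diag(f) = diag(f ∘ rev) · J₀`. [cite: Tits1979, §3.3.3] -/
theorem antidiagonal_mul_diagonal (f : Fin N → K) :
    (StdForm.antidiagonal N).over K * Matrix.diagonal f = Matrix.diagonal (fun i => f (Fin.rev i)) * (StdForm.antidiagonal N).over K := by
  have hJ : ∀ i j : Fin N, (StdForm.antidiagonal N).over K i j = if j = Fin.rev i then (1 : K) else 0 := by
    intro i j
    simp only [StdForm.over, Matrix.map_apply, StdForm.antidiagonal_J_apply]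
    split_ifs <;> simp
  ext i j
  rw [Matrix.mul_diagonal, Matrix.diagonal_mul, hJ]
  split_ifs with h
  · rw [h, one_mul, mul_one]
  · rw [zero_mul, mul_zero]

/-- **`latt J₀ = 𝒪^N`** (the antidiagonal permutation matrix is integral with integral inverse `J₀⁻¹ = J₀`). [cite: Tits1979, §3.3.3] -/
theorem latt_antidiagonal : latt ((StdForm.antidiagonal N).over K) = stdLattice K N := by
  have hJ : ∀ i j : Fin N, (StdForm.antidiagonal N).over K i j = if j = Fin.rev i then (1 : K) else 0 := by
    intro i j
    simp only [StdForm.over, Matrix.map_apply, StdForm.antidiagonal_J_apply]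
    split_ifs <;> simp
  have hint : IsIntMatrix ((StdForm.antidiagonal N).over K) := fun i j => by rw [hJ]; split_ifs <;> simp
  refine le_antisymm ((latt_le_stdLattice_iff _).2 hint) ?_
  rw [← latt_one, latt_le_latt_iff isUnit_det_antidiagonal, Matrix.mul_one, StdForm.inv_over]
  exact hint

/-- `latt (A · J₀) = latt A` (`J₀` permutes the coordinates of `𝒪^N`). [cite: Tits1979, §3.3.3] -/
theorem latt_mul_antidiagonal (A : Matrix (Fin N) (Fin N) K) : latt (A * (StdForm.antidiagonal N).over K) = latt A := by
  rw [latt_mul, latt_antidiagonal]; rfl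

/-- **The dual of a `ϖ`-power diagonal lattice at `J₀`**: `(latt diag(ϖ^{e_i}))^♯ = latt diag(ϖ^{−e_{rev i}})` (`σϖ = ϖ`, `σ` valuation-preserving). [cite: Jacobowitz1962, §4] [cite: Serre1980Trees, II.1.1] -/
theorem dualLatt_latt_diagonal_zpow (hvσ : ∀ a, Valued.v (σ a) = Valued.v a) (hσϖ : σ ϖ = ϖ) (hϖ0 : ϖ ≠ 0) (e : Fin N → ℤ) :
    dualLatt σ ((StdForm.antidiagonal N).over K) (latt (Matrix.diagonal fun i => ϖ ^ e i)) = latt (Matrix.diagonal fun i => ϖ ^ (-e (Fin.rev i))) := by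
  have hdet : IsUnit (Matrix.diagonal fun i => ϖ ^ e i : Matrix (Fin N) (Fin N) K).det := by
    rw [Matrix.det_diagonal]; exact isUnit_iff_ne_zero.2 (Finset.prod_ne_zero_iff.2 fun i _ => zpow_ne_zero _ hϖ0)
  rw [dualLatt_latt_eq σ hvσ isUnit_det_antidiagonal hdet]
  have hmap : (Matrix.diagonal fun i => ϖ ^ e i : Matrix (Fin N) (Fin N) K).map σ = Matrix.diagonal fun i => ϖ ^ e i := by
    rw [Matrix.diagonal_map (map_zero σ)]
    congr 1; funext i; rw [map_zpow₀, hσϖ]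
  rw [hmap, Matrix.diagonal_transpose]
  -- `(diag(ϖ^e) · J₀)⁻¹ = J₀ · diag(ϖ^{-e}) = diag(ϖ^{-e ∘ rev}) · J₀`
  have hinv : (Matrix.diagonal (fun i => ϖ ^ e i) * (StdForm.antidiagonal N).over K)⁻¹ =
      Matrix.diagonal (fun i => ϖ ^ (-e (Fin.rev i))) * (StdForm.antidiagonal N).over K := by
    apply Matrix.inv_eq_right_inv
    rw [Matrix.mul_assoc, ← Matrix.mul_assoc ((StdForm.antidiagonal N).over K), antidiagonal_mul_diagonal, Matrix.mul_assoc, StdForm.over_mul_over,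
      Matrix.mul_one, Matrix.diagonal_mul_diagonal, ← Matrix.diagonal_one]
    congr 1; funext i
    rw [Fin.rev_rev, ← zpow_add₀ hϖ0, add_neg_cancel, zpow_zero]
  rw [hinv, latt_mul_antidiagonal]

omit [Valued K ℤᵐ⁰] in
/-- `Fin 3` vectors of `ϖ`-powers as functions. [cite: Serre1980Trees, II.1.1] -/
theorem vec_three_zpow_eq (a b c : ℤ) : (![ϖ ^ a, ϖ ^ b, ϖ ^ c] : Fin 3 → K) = fun i => ϖ ^ (![a, b, c] : Fin 3 → ℤ) i := by
  funext i; fin_cases i <;> rfl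

/-- **Intersection at `N = 3`**: `latt diag(ϖ^a, ϖ^b, ϖ^c) ⊓ ϖ^j·𝒪³ = latt diag(ϖ^{max(a,j)}, ϖ^{max(b,j)}, ϖ^{max(c,j)})`. [cite: Serre1980Trees, II.1.1] -/
theorem latt_diagonal_three_inf_scaleLattice (hϖ : Valued.v ϖ = WithZero.exp (-1 : ℤ)) (a b c j : ℤ) :
    latt (Matrix.diagonal ![ϖ ^ a, ϖ ^ b, ϖ ^ c]) ⊓ scaleLattice (ϖ ^ j) (stdLattice K 3) = latt (Matrix.diagonal ![ϖ ^ max a j, ϖ ^ max b j, ϖ ^ max c j]) := by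
  rw [vec_three_zpow_eq, vec_three_zpow_eq, latt_diagonal_zpow_inf_scaleLattice_zpow hϖ]
  congr 2; funext i; fin_cases i <;> rfl

/-- **Duals at `N = 3`**: `(latt diag(ϖ^a, ϖ^b, ϖ^c))^♯ = latt diag(ϖ^{−c}, ϖ^{−b}, ϖ^{−a})`. [cite: Jacobowitz1962, §4] -/
theorem dualLatt_latt_diagonal_three (hvσ : ∀ a, Valued.v (σ a) = Valued.v a) (hσϖ : σ ϖ = ϖ) (hϖ0 : ϖ ≠ 0) (a b c : ℤ) :
    dualLatt σ ((StdForm.antidiagonal 3).over K) (latt (Matrix.diagonal ![ϖ ^ a, ϖ ^ b, ϖ ^ c])) = latt (Matrix.diagonal ![ϖ ^ (-c), ϖ ^ (-b), ϖ ^ (-a)]) := by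
  rw [vec_three_zpow_eq, vec_three_zpow_eq, dualLatt_latt_diagonal_zpow hvσ hσϖ hϖ0]
  congr 2; funext i; fin_cases i <;> rfl

omit [Valued K ℤᵐ⁰] in
/-- The apartment vertices with the middle entry spelled `ϖ^0`. [cite: Serre1980Trees, II.1.1] -/
theorem diagonal_one_mid_eq (a c : ℤ) : (Matrix.diagonal ![ϖ ^ a, (1 : K), ϖ ^ c] : Matrix (Fin 3) (Fin 3) K) = Matrix.diagonal ![ϖ ^ a, ϖ ^ (0 : ℤ), ϖ ^ c] := by
  rw [zpow_zero]

/-! ## §19 THE PARENT OF A SELF-DUAL VERTEX (`N = 3`): type two, strictly below, same depth -/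

/-- The self-dual frame element is not `0`: `latt diag(1,1,1) = 𝒪^3`. [cite: Serre1980Trees, II.1.1] -/
theorem latt_diagonal_zpow_zero : latt (Matrix.diagonal ![ϖ ^ (0 : ℤ), (1 : K), ϖ ^ (-(0 : ℤ))]) = stdLattice K 3 := by
  rw [neg_zero, zpow_zero, ← latt_one]
  congr 1
  ext i j; fin_cases i <;> fin_cases j <;> simp [Matrix.diagonal]

/-- **THE PARENT OF A SELF-DUAL VERTEX** (`N = 3`, `UnramifiedLocalConjDatum σ ϖ`).  Let `L ≠ 𝒪³` be a self-dual vertex of depth `k`.  Then `k ≥ 1` and `latticeParent σ ϖ J₀ L = L ⊓ ϖ^{1−k}𝒪³`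
is a vertex of TYPE `2`, STRICTLY BELOW `L`, of the SAME depth `k` (so one level up: level `2k − 1` vs `2k`).  Proof: `L = κ·latt diag(ϖ^a,1,ϖ^{−a})` (★ frames), `k = |a|`, `a ≠ 0`, and in the
frame the parent is `κ·latt diag(ϖ^a,1,ϖ^{1−a})` (`a ≥ 1`) resp. `κ·latt diag(ϖ^{1+a},1,ϖ^{−a})` (`a ≤ −1`). [cite: BruhatTits1972, §10] [cite: Serre1980Trees, II.1.1] -/
theorem latticeParent_spec_of_isSelfDualLattice (hd : UnramifiedLocalConjDatum σ ϖ) {L : Submodule 𝒪[K] (Fin 3 → K)}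
    (hL : IsSelfDualLattice σ ϖ ((StdForm.antidiagonal 3).over K) L) (hL0 : L ≠ stdLattice K 3) :
    1 ≤ latticeDepth ϖ L ∧
    IsVertexLattice σ ϖ ((StdForm.antidiagonal 3).over K) 2 (latticeParent σ ϖ ((StdForm.antidiagonal 3).over K) L) ∧
    latticeParent σ ϖ ((StdForm.antidiagonal 3).over K) L < L ∧
    latticeDepth ϖ (latticeParent σ ϖ ((StdForm.antidiagonal 3).over K) L) = latticeDepth ϖ L := by
  have hϖ0 : ϖ ≠ 0 := uniformizer_ne_zero hd.vϖ
  have hϖ1 : Valued.v ϖ ≤ 1 := by rw [hd.vϖ, ← WithZero.exp_zero, WithZero.exp_le_exp]; omega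
  obtain ⟨κ, hκ, a, rfl⟩ := exists_frame_three_of_isSelfDualLattice hd hL
  -- `a ≠ 0`
  have ha0 : a ≠ 0 := by
    rintro rfl
    exact hL0 (by rw [latt_diagonal_zpow_zero, mapGL_stdLattice_of_mem_unitaryInt hκ])
  -- depth `k = |a| ≥ 1`
  have hdepth : latticeDepth ϖ (mapGL (κ : GL (Fin 3) K) (latt (Matrix.diagonal ![ϖ ^ a, 1, ϖ ^ (-a)]))) = a.natAbs := by
    rw [latticeDepth_mapGL_of_mem_unitaryInt hκ, latticeDepth_latt_diagonal_zpow_selfDual hd.vϖ]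
  -- the parent in the frame
  have hsd := isSelfDualLattice_latt_diagonal_zpow (K := K) hd.σσ hd.σϖ hϖ1 hϖ0 a
  have hP : latticeParent σ ϖ ((StdForm.antidiagonal 3).over K) (mapGL (κ : GL (Fin 3) K) (latt (Matrix.diagonal ![ϖ ^ a, 1, ϖ ^ (-a)]))) =
      mapGL (κ : GL (Fin 3) K) (latt (Matrix.diagonal ![ϖ ^ max a (1 - (a.natAbs : ℤ)), ϖ ^ max (0 : ℤ) (1 - (a.natAbs : ℤ)), ϖ ^ max (-a) (1 - (a.natAbs : ℤ))])) := by
    rw [latticeParent_mapGL_of_mem_unitaryInt hκ, latticeParent, dualLatt_eq_self_of_isSelfDualLattice hd.vσ isUnit_det_antidiagonal hsd,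
      latticeDepth_latt_diagonal_zpow_selfDual hd.vϖ, diagonal_one_mid_eq, latt_diagonal_three_inf_scaleLattice hd.vϖ]
  refine ⟨by rw [hdepth]; omega, ?_, ?_, ?_⟩
  · -- type two
    rw [hP, isVertexLattice_mapGL_coe_iff]
    rcases le_or_gt 1 a with ha | ha
    · have h1 : max a (1 - (a.natAbs : ℤ)) = a := max_eq_left (by omega)
      have h2 : max (0 : ℤ) (1 - (a.natAbs : ℤ)) = 0 := max_eq_left (by omega)
      have h3 : max (-a) (1 - (a.natAbs : ℤ)) = 1 - a := by rw [max_eq_right (by omega)]; omega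
      rw [h1, h2, h3, zpow_zero]
      exact isVertexLattice_two_latt_diagonal_zpow hd.σσ hd.σϖ hϖ1 hϖ0 a
    · have ha' : a ≤ -1 := by omega
      have h1 : max a (1 - (a.natAbs : ℤ)) = 1 + a := by rw [max_eq_right (by omega)]; omega
      have h2 : max (0 : ℤ) (1 - (a.natAbs : ℤ)) = 0 := max_eq_left (by omega)
      have h3 : max (-a) (1 - (a.natAbs : ℤ)) = -a := max_eq_left (by omega)
      rw [h1, h2, h3, zpow_zero, show -a = 1 - (1 + a) by ring]
      exact isVertexLattice_two_latt_diagonal_zpow hd.σσ hd.σϖ hϖ1 hϖ0 (1 + a)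
  · -- strictly below
    refine lt_of_le_of_ne ?_ ?_
    · rw [latticeParent, dualLatt_eq_self_of_isSelfDualLattice hd.vσ isUnit_det_antidiagonal (isVertexLattice_mapGL σ ϖ _ _ κ.2 hsd)]
      exact inf_le_left
    · intro heq
      have h2 : IsVertexLattice σ ϖ ((StdForm.antidiagonal 3).over K) 2 (mapGL (κ : GL (Fin 3) K) (latt (Matrix.diagonal ![ϖ ^ a, 1, ϖ ^ (-a)]))) := by
        rw [← heq, hP, isVertexLattice_mapGL_coe_iff]
        rcases le_or_gt 1 a with ha | ha
        · have h1 : max a (1 - (a.natAbs : ℤ)) = a := max_eq_left (by omega)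
          have h2 : max (0 : ℤ) (1 - (a.natAbs : ℤ)) = 0 := max_eq_left (by omega)
          have h3 : max (-a) (1 - (a.natAbs : ℤ)) = 1 - a := by rw [max_eq_right (by omega)]; omega
          rw [h1, h2, h3, zpow_zero]
          exact isVertexLattice_two_latt_diagonal_zpow hd.σσ hd.σϖ hϖ1 hϖ0 a
        · have h1 : max a (1 - (a.natAbs : ℤ)) = 1 + a := by rw [max_eq_right (by omega)]; omega
          have h2 : max (0 : ℤ) (1 - (a.natAbs : ℤ)) = 0 := max_eq_left (by omega)
          have h3 : max (-a) (1 - (a.natAbs : ℤ)) = -a := max_eq_left (by omega)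
          rw [h1, h2, h3, zpow_zero, show -a = 1 - (1 + a) by ring]
          exact isVertexLattice_two_latt_diagonal_zpow hd.σσ hd.σϖ hϖ1 hϖ0 (1 + a)
      have h0 : IsVertexLattice σ ϖ ((StdForm.antidiagonal 3).over K) 0 (mapGL (κ : GL (Fin 3) K) (latt (Matrix.diagonal ![ϖ ^ a, 1, ϖ ^ (-a)]))) :=
        isVertexLattice_mapGL σ ϖ _ _ κ.2 hsd
      exact absurd (type_unique hd.vσ hd.vϖ h2 h0) (by norm_num)
  · -- same depth
    rw [hP, latticeDepth_mapGL_of_mem_unitaryInt hκ, hdepth]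
    rcases le_or_gt 1 a with ha | ha
    · have h1 : max a (1 - (a.natAbs : ℤ)) = a := max_eq_left (by omega)
      have h2 : max (0 : ℤ) (1 - (a.natAbs : ℤ)) = 0 := max_eq_left (by omega)
      have h3 : max (-a) (1 - (a.natAbs : ℤ)) = 1 - a := by rw [max_eq_right (by omega)]; omega
      rw [h1, h2, h3, zpow_zero, latticeDepth_latt_diagonal_zpow_two hd.vϖ]
      omega
    · have h1 : max a (1 - (a.natAbs : ℤ)) = 1 + a := by rw [max_eq_right (by omega)]; omega
      have h2 : max (0 : ℤ) (1 - (a.natAbs : ℤ)) = 0 := max_eq_left (by omega)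
      have h3 : max (-a) (1 - (a.natAbs : ℤ)) = -a := max_eq_left (by omega)
      rw [h1, h2, h3, zpow_zero, show -a = 1 - (1 + a) by ring, latticeDepth_latt_diagonal_zpow_two hd.vϖ]
      omega

end Literature.NumberTheory.Automorphic.UnitaryLatticeTree


end
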